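import Mathlib
import Summits.Ventures.PercRepro2.Defs
import Summits.Ventures.PercRepro2.Harris
import Summits.Ventures.PercRepro2.CoinDefs
import Summits.Ventures.PercRepro2.CoinArcsOff
import Summits.Ventures.PercRepro2.CoinReverse
import Summits.Ventures.PercRepro2.CoinDarcMixed
import Summits.Ventures.PercRepro2.CoinKStarLaw
import Summits.Ventures.PercRepro2.CoinStarAlg
import Summits.Ventures.PercRepro2.CoinStarDefs

/-!
# Row 2′DARC over a STAR CORE at EVERY head (blind cell PercRepro2, night-2 g7;
proofs/NIGHT2-DARC.md §30)

A STAR CORE: the root `s` has the independent single-arc coins `c v = {s → v}` (`v ∈ C`) as its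
only out-arcs, these are the only arcs into `C`, and nothing enters `s`.  The rest of the system
(the «head»: entries from `C` and whatever lies beyond, `t` included) is ARBITRARY mixed.  By the
star mass decomposition (`CoinStarDefs.lean`) every mass of row 2′DARC is a sum over `L ⊆ C` of
`leafLaw(L) · A(L′) · (marker data)` with `A(X) = P(X ↛ t in D − (arcs out of s))`, which is
LOG-SUPERMODULAR by the reversed van den Berg–Kahn inequality (`vdBKC_rev`).  Splitting on
`u ∈ L` (`star_split`), `starCore_functional_nonneg` (CoinStarAlg.lean) closes:
**row 2′DARC holds at the arc `u → w` for every head** (`darc_of_starCore`) — the first theorem of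
the row in which the structure beyond the gate head is unconstrained (the OR-fork family of §28,
where the tilt lemma fails, is an instance).
-/

namespace Summit.Ventures.PercRepro2.Coin

open Classical

section StarMain

variable {V : Type*} {E : Type*} [Fintype V] [DecidableEq V] [Fintype E] [DecidableEq E]
  {R : Type*} [Field R] [LinearOrder R] [IsStrictOrderedRing R]

omit [Fintype V] [Fintype E] [DecidableEq E] [LinearOrder R] [IsStrictOrderedRing R] in
/-- The product law over `insert u C₀` at a set not containing `u`. -/
lemma leafLaw_insert_of_notMem (C₀ : Finset V) (β : V → R) {u : V} (hu : u ∉ C₀) {L : Finset V}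
    (huL : u ∉ L) : leafLaw (insert u C₀) β L = (1 - β u) * leafLaw C₀ β L := by
  simp only [leafLaw]
  rw [Finset.prod_insert hu]
  simp [huL]

omit [Fintype V] [Fintype E] [DecidableEq E] [LinearOrder R] [IsStrictOrderedRing R] in
/-- The product law over `insert u C₀` at `insert u L`. -/
lemma leafLaw_insert_insert (C₀ : Finset V) (β : V → R) {u : V} (hu : u ∉ C₀) (L : Finset V) :
    leafLaw (insert u C₀) β (insert u L) = β u * leafLaw C₀ β L := by
  simp only [leafLaw]
  rw [Finset.prod_insert hu]
  simp only [Finset.mem_insert_self, if_true]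
  congr 1
  refine Finset.prod_congr rfl fun i hi => ?_
  have hiu : i ≠ u := fun h' => hu (h' ▸ hi)
  simp [Finset.mem_insert, hiu]

variable {arcs : E → Finset (V × V)} {s : V} {C : Finset V} {c : V → E}

omit [Fintype V] [LinearOrder R] [IsStrictOrderedRing R] in
/-- Splitting a star sum on the tail coin `u`: the sum over `C.powerset` is the `(1 − p(c u))`-part
over the subsets of `C ∖ {u}` plus the `p(c u)`-part over the same subsets with `u` inserted. -/
lemma StarCore.star_split (_h : StarCore arcs s C c) (p : E → R) (t : V) {u : V} (hu : u ∈ C)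
    (X : Finset V → Finset V) (g : Finset V → R) :
    ∑ L ∈ C.powerset, g L * (leafLaw C (fun v => p (c v)) L *
        prob p (starAvoidEvent arcs s t (X L))) =
      (1 - p (c u)) * ∑ L ∈ (C.erase u).powerset, leafLaw (C.erase u) (fun v => p (c v)) L *
          prob p (starAvoidEvent arcs s t (X L)) * g L
      + p (c u) * ∑ L ∈ (C.erase u).powerset, leafLaw (C.erase u) (fun v => p (c v)) L *
          prob p (starAvoidEvent arcs s t (X (insert u L))) * g (insert u L) := by
  have huC₀ : u ∉ C.erase u := Finset.notMem_erase u C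
  have hC : C = insert u (C.erase u) := (Finset.insert_erase hu).symm
  conv_lhs => rw [hC]
  rw [Finset.sum_powerset_insert huC₀, Finset.mul_sum, Finset.mul_sum]
  congr 1
  · refine Finset.sum_congr rfl fun L hL => ?_
    have huL : u ∉ L := fun h' => huC₀ (Finset.mem_powerset.mp hL h')
    rw [leafLaw_insert_of_notMem _ _ huC₀ huL]; ring
  · refine Finset.sum_congr rfl fun L _ => ?_
    rw [leafLaw_insert_insert _ _ huC₀]; ring

/-- **THEOREM (row 2′DARC over a star core, every head).**  Let the root `s` have a star core
`C` (`StarCore`), let `a, b, u ∈ C` with `a, b ≠ u`, and let the gate head `w ∉ C ∪ {s}` be any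
other vertex (the structure beyond `C` — entries from `C`, the head, the target `t ≠ s` — is an
ARBITRARY mixed coin system).  If the two reduced masses
`M₀ = Σ_{L ⊆ C∖u} leafLaw(L) · P(L ↛ t)` and `M' = Σ_{L ⊆ C∖u} leafLaw(L) · P(L ∪ {u, w} ↛ t)`
(reachability in `D − (arcs out of s)`) are positive, then `Φ_D({s ↛ t in D + (u → w)}) ≥ 0`. -/
theorem darc_of_starCore (p : E → R) (hp : IsProbVec p) (hS : SameEnds arcs)
    (h : StarCore arcs s C c) {t : V} (ht : t ≠ s) {a b u w : V} (ha : a ∈ C) (hb : b ∈ C)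
    (hu : u ∈ C) (hau : a ≠ u) (hbu : b ≠ u) (hws : w ≠ s) (hwC : w ∉ C)
    (hM₀ : 0 < ∑ L ∈ (C.erase u).powerset, leafLaw (C.erase u) (fun v => p (c v)) L *
      prob p (starAvoidEvent arcs s t L))
    (hM' : 0 < ∑ L ∈ (C.erase u).powerset, leafLaw (C.erase u) (fun v => p (c v)) L *
      prob p (starAvoidEvent arcs s t (insert w (insert u L)))) :
    DARC p arcs s {t} a b u w := by
  set C₀ := C.erase u with hC₀
  have huC₀ : u ∉ C₀ := Finset.notMem_erase u C
  have hwC₀ : w ∉ C₀ := fun h' => hwC (Finset.mem_of_mem_erase h')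
  set β : Finset V → R := leafLaw C₀ (fun v => p (c v)) with hβ
  set A : Finset V → R := fun X => prob p (starAvoidEvent arcs s t X) with hA
  set x : Finset V → R := fun L => if a ∈ L then 1 else 0 with hx
  set y : Finset V → R := fun L => if b ∈ L then 1 else 0 with hy
  -- the markers on the star cylinders
  have hxc : ∀ L ⊆ C, ∀ ω ∈ starCyl C c L, marker (R := R) arcs s a ω = x L :=
    fun L hL ω hω => h.marker_on_starCyl hL ha hω
  have hyc : ∀ L ⊆ C, ∀ ω ∈ starCyl C c L, marker (R := R) arcs s b ω = y L :=
    fun L hL ω hω => h.marker_on_starCyl hL hb hω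
  have hxyc : ∀ L ⊆ C, ∀ ω ∈ starCyl C c L,
      (fun ω => marker (R := R) arcs s a ω * marker (R := R) arcs s b ω) ω = x L * y L :=
    fun L hL ω hω => by simp only [hxc L hL ω hω, hyc L hL ω hω]
  have h1c : ∀ L ⊆ C, ∀ ω ∈ starCyl C c L, (fun _ : Config E => (1 : R)) ω = (fun _ => (1 : R)) L :=
    fun _ _ _ _ => rfl
  -- `u` is not in the subsets of `C₀`; the gate target on the two halves
  have hxu : ∀ L ⊆ C₀, x (insert u L) = x L := by
    intro L _; simp only [hx, Finset.mem_insert, hau, false_or]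
  have hyu : ∀ L ⊆ C₀, y (insert u L) = y L := by
    intro L _; simp only [hy, Finset.mem_insert, hbu, false_or]
  have htg0 : ∀ L ⊆ C₀, starTarget u w L = L := by
    intro L hL
    have : u ∉ L := fun h' => huC₀ (hL h')
    simp [starTarget, this]
  have htg1 : ∀ L : Finset V, starTarget u w (insert u L) = insert w (insert u L) := by
    intro L; simp [starTarget]
  -- the seven masses
  have hR := h.avoid_eq_biUnion ht
  have hG := h.gate_eq_biUnion ht hu hws
  have hPR : prob p (avoidEvent arcs s {t}) =
      (1 - p (c u)) * ∑ L ∈ C₀.powerset, β L * A L + p (c u) * ∑ L ∈ C₀.powerset, β L * A (insert u L) := by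
    rw [prob_eq_massE_one, hR, h.star_mass p t (fun L => L) h1c, h.star_split p t hu]
    simp only [mul_one]
    rfl
  have hXR : massE p (marker (R := R) arcs s a) (avoidEvent arcs s {t}) =
      (1 - p (c u)) * ∑ L ∈ C₀.powerset, β L * A L * x L
        + p (c u) * ∑ L ∈ C₀.powerset, β L * A (insert u L) * x L := by
    rw [hR, h.star_mass p t (fun L => L) hxc, h.star_split p t hu]
    congr 2
    exact Finset.sum_congr rfl fun L hL => by rw [hxu L (Finset.mem_powerset.mp hL)]
  have hYR : massE p (marker (R := R) arcs s b) (avoidEvent arcs s {t}) =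
      (1 - p (c u)) * ∑ L ∈ C₀.powerset, β L * A L * y L
        + p (c u) * ∑ L ∈ C₀.powerset, β L * A (insert u L) * y L := by
    rw [hR, h.star_mass p t (fun L => L) hyc, h.star_split p t hu]
    congr 2
    exact Finset.sum_congr rfl fun L hL => by rw [hyu L (Finset.mem_powerset.mp hL)]
  have hPG : prob p (gateEvent arcs s {t} u w) =
      (1 - p (c u)) * ∑ L ∈ C₀.powerset, β L * A L
        + p (c u) * ∑ L ∈ C₀.powerset, β L * A (insert w (insert u L)) := by
    rw [prob_eq_massE_one, hG, h.star_mass p t (starTarget u w) h1c, h.star_split p t hu]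
    simp only [mul_one]
    congr 2
    · exact Finset.sum_congr rfl fun L hL => by rw [htg0 L (Finset.mem_powerset.mp hL)]
    · exact Finset.sum_congr rfl fun L _ => by rw [htg1 L]
  have hXG : massE p (marker (R := R) arcs s a) (gateEvent arcs s {t} u w) =
      (1 - p (c u)) * ∑ L ∈ C₀.powerset, β L * A L * x L
        + p (c u) * ∑ L ∈ C₀.powerset, β L * A (insert w (insert u L)) * x L := by
    rw [hG, h.star_mass p t (starTarget u w) hxc, h.star_split p t hu]
    congr 2
    · exact Finset.sum_congr rfl fun L hL => by rw [htg0 L (Finset.mem_powerset.mp hL)]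
    · exact Finset.sum_congr rfl fun L hL => by
        rw [htg1 L, hxu L (Finset.mem_powerset.mp hL)]
  have hYG : massE p (marker (R := R) arcs s b) (gateEvent arcs s {t} u w) =
      (1 - p (c u)) * ∑ L ∈ C₀.powerset, β L * A L * y L
        + p (c u) * ∑ L ∈ C₀.powerset, β L * A (insert w (insert u L)) * y L := by
    rw [hG, h.star_mass p t (starTarget u w) hyc, h.star_split p t hu]
    congr 2
    · exact Finset.sum_congr rfl fun L hL => by rw [htg0 L (Finset.mem_powerset.mp hL)]
    · exact Finset.sum_congr rfl fun L hL => by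
        rw [htg1 L, hyu L (Finset.mem_powerset.mp hL)]
  have hXYG : massE p (fun ω => marker (R := R) arcs s a ω * marker (R := R) arcs s b ω)
      (gateEvent arcs s {t} u w) =
      (1 - p (c u)) * ∑ L ∈ C₀.powerset, β L * A L * (x L * y L)
        + p (c u) * ∑ L ∈ C₀.powerset, β L * A (insert w (insert u L)) * (x L * y L) := by
    rw [hG, h.star_mass p t (starTarget u w) hxyc, h.star_split p t hu]
    congr 2
    · exact Finset.sum_congr rfl fun L hL => by rw [htg0 L (Finset.mem_powerset.mp hL)]
    · exact Finset.sum_congr rfl fun L hL => by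
        rw [htg1 L, hxu L (Finset.mem_powerset.mp hL), hyu L (Finset.mem_powerset.mp hL)]
  -- the hypotheses of the abstract lemma
  have hq : 0 ≤ 1 - p (c u) := by linarith [hp.le_one (c u)]
  have hr : 0 ≤ p (c u) := hp.nonneg (c u)
  have hβ0 : ∀ L ⊆ C₀, 0 ≤ β L := fun L _ =>
    leafLaw_nonneg (fun v _ => hp.nonneg (c v)) (fun v _ => hp.le_one (c v)) L
  have hβlsm : ∀ L L', L ⊆ C₀ → L' ⊆ C₀ → β L * β L' ≤ β (L ∩ L') * β (L ∪ L') :=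
    fun L L' _ _ => (leafLaw_mul C₀ _ L L').le
  have hA0 : ∀ X ⊆ insert w (insert u C₀), 0 ≤ A X := fun X _ => prob_nonneg hp _
  have hAlsm : ∀ X Y, X ⊆ insert w (insert u C₀) → Y ⊆ insert w (insert u C₀) →
      A X * A Y ≤ A (X ∩ Y) * A (X ∪ Y) := by
    intro X Y _ _
    have hh := vdBKC_rev p hp (sameEnds_arcsOff hS {s}) t ∅ ∅ X Y
    simp only [hA, starAvoidEvent]
    simpa only [Finset.notMem_empty, false_imp_iff, implies_true, Set.setOf_true, Set.univ_inter,
      Finset.empty_union] using hh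
  have hx0 : ∀ L ⊆ C₀, 0 ≤ x L := by
    intro L _; simp only [hx]; split_ifs <;> norm_num
  have hy0 : ∀ L ⊆ C₀, 0 ≤ y L := by
    intro L _; simp only [hy]; split_ifs <;> norm_num
  have hxm : ∀ L L', L ⊆ L' → L' ⊆ C₀ → x L ≤ x L' := by
    intro L L' hLL' _; simp only [hx]
    by_cases haL : a ∈ L
    · simp [haL, hLL' haL]
    · simp only [haL, if_false]; split_ifs <;> norm_num
  have hym : ∀ L L', L ⊆ L' → L' ⊆ C₀ → y L ≤ y L' := by
    intro L L' hLL' _; simp only [hy]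
    by_cases hbL : b ∈ L
    · simp [hbL, hLL' hbL]
    · simp only [hbL, if_false]; split_ifs <;> norm_num
  have key := starCore_functional_nonneg C₀ u w huC₀ hwC₀ β A x y (1 - p (c u)) (p (c u)) hq hr
    hβ0 hβlsm hA0 hAlsm hx0 hy0 hxm hym hM₀ hM'
  unfold DARC phiC
  simp only
  rw [hPR, hXR, hYR, hPG, hXG, hYG, hXYG]
  exact key

end StarMain


end Summit.Ventures.PercRepro2.Coin
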